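import Literature.AlgebraicTopology.Homotopy.TubeCollapse
import Literature.AlgebraicTopology.SingularHomology.RelativeCochainsExcision
import HarnessLib

/-!
# The collapse map of a tube is nonzero on top-degree cohomology

The cohomological half of the Pontryagin–Thom collapse in the elementary form used for Wu-class
arguments (Milnor–Stasheff, *Characteristic classes* (1974), §18 pp. 215–216; Browder,
*Surgery on simply-connected manifolds* (1972), §II.2): in the situation of `TubeCollapse.lean`
— `W` compact Hausdorff, `X ⊆ W` open and nonempty, `t : W × [0,1]ᴺ ↪ S` a closed tube in a
compact Hausdorff space `S` with open tube `To = t (X × (0,1)ᴺ)` open, and the collapse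
`g : S → Z := Sᴺ X⁺` — suppose that in some degree `M` and over a coefficient ring `R`

* `Hᴹ(S ∖ {s}; R) = 0` for every point `s` (e.g. `S` a sphere `Sᴹ`, `M ≥ 1`), and
* `Hᴹ(S; R) ≠ 0`.

Then **`g^* : Hᴹ(Z; R) → Hᴹ(S; R)` is nonzero** (`tubeCollapse.exists_map_ne_zero`). Proof: pick
`x₀ ∈ X`, a compact neighbourhood `K` of `x₀` in `X` and the box `C = [3/8, 5/8]ᴺ`; let
`V ⊆ Z` be the image of `K° × C°` under the open embedding `ι' : X × (0,1)ᴺ → Z` and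
`V_S = g⁻¹(V) ⊆ To`. In the commutative square of pairs

  `(To, To ∖ V_S) → (S, S ∖ V_S)`, `(U, U ∖ V) → (Z, Z ∖ V)`, `g : (S, S ∖ V_S) → (Z, Z ∖ V)`,

the horizontal maps are EXCISION isomorphisms (`RelativeCochainsExcision.lean`; the closures of
`V`, `V_S` are contained in the open sets `U = ι'(X × (0,1)ᴺ)`, `To` — here the Hausdorff
property of `Z`, `IteratedSuspension.lean`, and compactness of `K × C` are used) and
`g| : To → U` is a homeomorphism of pairs, so `g^* : Hᴹ(Z, Z ∖ V) ≅ Hᴹ(S, S ∖ V_S)`; and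
`Hᴹ(S, S ∖ V_S) → Hᴹ(S)` is onto because `Hᴹ(S) → Hᴹ(S ∖ V_S)` factors through
`Hᴹ(S ∖ {s₀}) = 0` (`s₀ = t (x₀, ½) ∈ V_S`). A nonzero `a ∈ Hᴹ(S)` thus lifts to `Hᴹ(S, S ∖ V_S)`,
comes from `ω ∈ Hᴹ(Z, Z ∖ V)`, and `g^*` of the image of `ω` in `Hᴹ(Z)` is `a ≠ 0`.

Everything is proved; no named facts.

## References

* J. Milnor, J. Stasheff, *Characteristic classes*, Princeton UP 1974, §18 pp. 215–216.
  [MilnorStasheff1974]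
* A. Hatcher, *Algebraic Topology*, CUP 2002, §3.1 p. 201 (excision), §2.1 Prop. 2.22.
  [Hatcher2002]
-/

noncomputable section

open CategoryTheory CategoryTheory.Limits unitInterval Set Function OnePoint
open Literature.AlgebraicTopology.Homotopy
open _root_.Topology

universe u v

namespace Literature.AlgebraicTopology.SingularHomology

/-! ### Relative cohomology and homeomorphisms of pairs -/

section PairIso

variable (R : Type v) [CommRing R] (M' : Type v) [AddCommGroup M'] [Module R M']
variable {X Y : Type u} [TopologicalSpace X] [TopologicalSpace Y]

/-- **A homeomorphism of pairs induces isomorphisms on relative cohomology.** [folklore] -/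
theorem relSingularCohomology.isIso_map_of_homeomorph (e : X ≃ₜ Y) {A : Set X} {B : Set Y}
    (hA : Set.MapsTo e A B) (hB : Set.MapsTo e.symm B A) (n : ℕ) :
    IsIso (relSingularCohomology.map R M' (e : C(X, Y)) hA n) := by
  refine ⟨⟨relSingularCohomology.map R M' (e.symm : C(Y, X)) hB n, ?_, ?_⟩⟩
  · rw [← relSingularCohomology.map_comp]
    have h : ((e : C(X, Y)).comp (e.symm : C(Y, X))) = ContinuousMap.id Y := by
      ext y; exact e.apply_symm_apply y
    rw [relSingularCohomology.map_congr h (hA.comp hB) (Set.mapsTo_id B),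
      relSingularCohomology.map_id]
  · rw [← relSingularCohomology.map_comp]
    have h : ((e.symm : C(Y, X)).comp (e : C(X, Y))) = ContinuousMap.id X := by
      ext x; exact e.symm_apply_apply x
    rw [relSingularCohomology.map_congr h (hB.comp hA) (Set.mapsTo_id A),
      relSingularCohomology.map_id]

end PairIso

/-! ### The collapse map is nonzero on `Hᴹ` -/

namespace tubeCollapse

open Literature.AlgebraicTopology.Homotopy.tubeCollapse

variable (R : Type v) [CommRing R]
variable {W : Type u} [TopologicalSpace W] [CompactSpace W] [T2Space W] {X : Set W}
variable {S : Type u} [TopologicalSpace S] [CompactSpace S] [T2Space S]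
variable {N : ℕ} {t : W × (Fin N → I) → S}

/-- The box coordinates: `r ↦ r` from `[3/8, 5/8]` into `(0, 1)`. [folklore] -/
def boxCoord (r : Set.Icc (3 / 8 : ℝ) (5 / 8)) : Susp.midHeights :=
  ⟨⟨r.1, by have := r.2.1; have := r.2.2; constructor <;> linarith⟩, by
    have h1 := r.2.1; have h2 := r.2.2
    exact ⟨show (0 : ℝ) < r.1 by linarith, show (r.1 : ℝ) < 1 by linarith⟩⟩

omit [CompactSpace W] [T2Space W] in
/-- `boxCoord` is continuous. [folklore] -/
lemma continuous_boxCoord : Continuous boxCoord :=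
  (continuous_subtype_val.subtype_mk _).subtype_mk _

/-- The closed box `C = [3/8, 5/8]ᴺ ⊆ (0,1)ᴺ` (compact, as a continuous image of a compact cube).
[folklore] -/
def closedBox (N : ℕ) : Set (Fin N → Susp.midHeights) :=
  range fun θ : Fin N → Set.Icc (3 / 8 : ℝ) (5 / 8) => fun i => boxCoord (θ i)

/-- The closed box is compact. [folklore] -/
lemma isCompact_closedBox : IsCompact (closedBox N) :=
  isCompact_range (continuous_pi fun i => continuous_boxCoord.comp (continuous_apply i))

/-- The open box `C° = (3/8, 5/8)ᴺ`. [folklore] -/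
def openBox (N : ℕ) : Set (Fin N → Susp.midHeights) :=
  {θ | ∀ i, (3 / 8 : ℝ) < (θ i).1 ∧ ((θ i).1 : ℝ) < 5 / 8}

/-- The open box is open. [folklore] -/
lemma isOpen_openBox : IsOpen (openBox N) := by
  have : openBox N = ⋂ i, {θ : Fin N → Susp.midHeights | (3 / 8 : ℝ) < (θ i).1 ∧ ((θ i).1 : ℝ) < 5 / 8} := by
    ext θ; simp [openBox]
  rw [this]
  refine isOpen_iInter_of_finite fun i => ?_
  have hc : Continuous fun θ : Fin N → Susp.midHeights => ((θ i).1 : ℝ) :=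
    continuous_subtype_val.comp (continuous_subtype_val.comp (continuous_apply i))
  exact (isOpen_lt continuous_const hc).inter (isOpen_lt hc continuous_const)

/-- `C° ⊆ C`. [folklore] -/
lemma openBox_subset_closedBox : openBox N ⊆ closedBox N := fun θ hθ =>
  ⟨fun i => ⟨(θ i).1, (hθ i).1.le, (hθ i).2.le⟩, funext fun _ => Subtype.ext (Subtype.ext rfl)⟩

/-- The centre `(½, …, ½)` of the box. [folklore] -/
def boxCentre (N : ℕ) : Fin N → Susp.midHeights := fun _ => ⟨Susp.mid, Susp.mid_mem_midHeights⟩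

/-- The centre lies in the open box. [folklore] -/
lemma boxCentre_mem_openBox : boxCentre N ∈ openBox N := fun i => by
  change (3 / 8 : ℝ) < 1 / 2 ∧ (1 / 2 : ℝ) < 5 / 8; norm_num

variable (X N) in
/-- The parametrisation `ι' : X × (0,1)ᴺ → Z` of the open part. [folklore] -/
abbrev ι' (p : X × (Fin N → Susp.midHeights)) : suspN (OnePoint X) N :=
  suspN.ι N ((p.1 : OnePoint X), p.2)

variable (t) in
/-- The parametrisation `e_S : X × (0,1)ᴺ → To` of the open tube. [folklore] -/
def eS (p : X × (Fin N → Susp.midHeights)) : openTube X t :=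
  ⟨t ((p.1 : W), fun i => (p.2 i).1), ⟨((p.1 : W), fun i => (p.2 i).1),
    ⟨p.1.2, fun i _ => (p.2 i).2⟩, rfl⟩⟩

omit [CompactSpace W] [T2Space W] [CompactSpace S] [T2Space S] in
/-- `e_S` is continuous. [folklore] -/
lemma continuous_eS (ht : Continuous t) : Continuous (eS t (X := X)) :=
  (ht.comp ((continuous_subtype_val.comp continuous_fst).prodMk
    (continuous_pi fun i => continuous_subtype_val.comp ((continuous_apply i).comp
      continuous_snd)))).subtype_mk _

omit [TopologicalSpace W] [CompactSpace W] [T2Space W] [TopologicalSpace S] [CompactSpace S]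
  [T2Space S] in
/-- `e_S` is onto the open tube. [folklore] -/
lemma eS_surjective : Surjective (eS t (X := X)) := by
  rintro ⟨_, ⟨w, θ⟩, ⟨hw, hθ⟩, rfl⟩
  exact ⟨(⟨w, hw⟩, fun i => ⟨θ i, hθ i (mem_univ i)⟩), rfl⟩

omit [CompactSpace S] in
/-- **The collapse is nonzero on `Hᴹ`** (Milnor–Stasheff 1974, §18; the cohomological content
of the Pontryagin–Thom collapse in suspension form): if `Hᴹ(S ∖ {s}; R) = 0` for all `s` and
`Hᴹ(S; R) ≠ 0`, then `g^* : Hᴹ(Sᴺ X⁺; R) → Hᴹ(S; R)` is nonzero. See the module docstring for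
the proof. [cite: MilnorStasheff1974, §18 pp. 215–216] -/
theorem exists_map_ne_zero (hX : IsOpen X) (x₀ : X) (ht : Continuous t) (hinj : Injective t)
    (hTo : IsOpen (openTube X t)) {τ : C(S, Fin N → I)}
    (hτ : ∀ x : W × (Fin N → I), t x ∉ openTube X t → τ (t x) = x.2) (M : ℕ)
    (hS₀ : ∀ s₀ : S, IsZero (singularCohomology R R ({s₀}ᶜ : Set S) M))
    (hSM : ¬ IsZero (singularCohomology R R S M)) :
    ∃ y : singularCohomology R R (suspN (OnePoint X) N) M,
      singularCohomology.map R R ⟨map X ht hinj τ, continuous_map hX ht hinj hTo hτ⟩ M y ≠ 0 := by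
  haveI : LocallyCompactSpace X := hX.locallyCompactSpace
  -- notation
  set Z := suspN (OnePoint X) N with hZ
  let g : C(S, Z) := ⟨map X ht hinj τ, continuous_map hX ht hinj hTo hτ⟩
  have hg : ∀ s, g s = map X ht hinj τ s := fun _ => rfl
  let U : Set Z := openPart X N
  let To : Set S := openTube X t
  have hιemb : IsOpenEmbedding (ι' X N) := isOpenEmbedding_openPart
  -- the neighbourhood `V`
  obtain ⟨K, hKc, hKn⟩ := exists_compact_mem_nhds x₀
  let V : Set Z := ι' X N '' (interior K ×ˢ openBox N)
  have hVo : IsOpen V := hιemb.isOpenMap _ (isOpen_interior.prod isOpen_openBox)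
  have hVU : closure V ⊆ U := by
    have h1 : V ⊆ ι' X N '' (K ×ˢ closedBox N) :=
      image_mono (prod_mono interior_subset openBox_subset_closedBox)
    have h2 : IsClosed (ι' X N '' (K ×ˢ closedBox N)) :=
      ((hKc.prod isCompact_closedBox).image hιemb.continuous).isClosed
    exact (closure_minimal h1 h2).trans (image_subset_range _ _)
  -- the pulled back neighbourhood `V_S`
  let VS : Set S := g ⁻¹' V
  have hVSTo : VS ⊆ To := fun s hs =>
    (mem_openTube_iff ht hinj τ s).1 (image_subset_range _ _ hs)
  have hVS_closure : closure VS ⊆ To := by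
    -- `VS ⊆ t (K × C_I)`, compact, inside `To`
    let CI : Set (Fin N → I) := {θ | ∀ i, (3 / 8 : ℝ) ≤ θ i ∧ (θ i : ℝ) ≤ 5 / 8}
    have hCIc : IsClosed CI := by
      have : CI = ⋂ i, {θ : Fin N → I | (3 / 8 : ℝ) ≤ θ i ∧ (θ i : ℝ) ≤ 5 / 8} := by
        ext θ; simp [CI]
      rw [this]
      refine isClosed_iInter fun i => ?_
      have hc : Continuous fun θ : Fin N → I => ((θ i : I) : ℝ) :=
        continuous_subtype_val.comp (continuous_apply i)
      exact (isClosed_le continuous_const hc).inter (isClosed_le hc continuous_const)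
    have hTK : IsClosed (t '' ((Subtype.val '' K) ×ˢ CI)) :=
      ((((hKc.image continuous_subtype_val)).prod hCIc.isCompact).image ht).isClosed
    have h1 : VS ⊆ t '' ((Subtype.val '' K) ×ˢ CI) := by
      intro s hs
      have hsTo : s ∈ To := hVSTo hs
      obtain ⟨p, rfl⟩ := eS_surjective ⟨s, hsTo⟩ |>.imp fun p hp => congrArg Subtype.val hp
      -- `g (eS p) = ι' p ∈ V`
      have hgp : g (eS t p).1 = ι' X N p := by
        rw [hg]; exact map_tube_coe ht hinj τ p.1 p.2
      have hpV : ι' X N p ∈ V := by rw [← hgp]; exact hs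
      obtain ⟨p', hp', he⟩ := hpV
      have hpp : p' = p := hιemb.injective he
      subst hpp
      refine ⟨((p'.1 : W), fun i => (p'.2 i).1), ⟨⟨p'.1, interior_subset hp'.1, rfl⟩, fun i =>
        ⟨(hp'.2 i).1.le, (hp'.2 i).2.le⟩⟩, rfl⟩
    have h2 : t '' ((Subtype.val '' K) ×ˢ CI) ⊆ To := by
      rintro _ ⟨⟨w, θ⟩, ⟨⟨x, hx, rfl⟩, hθ⟩, rfl⟩
      exact ⟨(x.1, θ), ⟨x.2, fun i _ => ⟨by have := (hθ i).1; linarith, by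
        have := (hθ i).2; linarith⟩⟩, rfl⟩
    exact (closure_minimal h1 hTK).trans h2
  -- the base point `s₀ ∈ V_S`
  let s₀ : S := (eS t (x₀, boxCentre N)).1
  have hs₀ : s₀ ∈ VS := by
    change g (eS t (x₀, boxCentre N)).1 ∈ V
    rw [hg, show (eS t (x₀, boxCentre N)).1 = t ((x₀ : W), fun i => (boxCentre N i).1) from rfl,
      map_tube_coe ht hinj τ]
    exact ⟨(x₀, boxCentre N), ⟨mem_interior_iff_mem_nhds.2 hKn, boxCentre_mem_openBox⟩, rfl⟩
  -- (E4) `Hᴹ(S, S ∖ V_S) → Hᴹ(S)` is onto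
  have hres0 : singularCohomology.map R R (subsetIncl VSᶜ) M = 0 := by
    have hsub : VSᶜ ⊆ ({s₀}ᶜ : Set S) := compl_subset_compl.2 (singleton_subset_iff.2 hs₀)
    have hfac : subsetIncl VSᶜ = (subsetIncl ({s₀}ᶜ : Set S)).comp
        ⟨Set.inclusion hsub, continuous_inclusion hsub⟩ := by ext; rfl
    rw [hfac, singularCohomology.map_comp]
    have hz : singularCohomology.map R R (subsetIncl ({s₀}ᶜ : Set S)) M = 0 :=
      (hS₀ s₀).eq_of_tgt _ _
    rw [hz, zero_comp]
  have hsurj : Function.Surjective (relSingularCohomology.toAbsolute R R S VSᶜ M) := by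
    rw [← ModuleCat.epi_iff_surjective]
    exact (relSingularCohomology.exact_toAbsolute_map (R := R) (M := R) VSᶜ M).epi_f hres0
  -- (E1), (E2) excision isomorphisms
  have hexcZ : IsIso (relSingularCohomology.map R R (subsetIncl U)
      (Set.mapsTo_preimage Subtype.val Vᶜ : Set.MapsTo (subsetIncl U) (Subtype.val ⁻¹' Vᶜ) Vᶜ) M) := by
    refine relSingularCohomology.isIso_map_subsetIncl_of_interior R R Vᶜ U ?_ M
    rw [interior_compl, (isOpen_openPart : IsOpen U).interior_eq]
    exact eq_univ_of_forall fun z => (em (z ∈ closure V)).elim (fun h => Or.inr (hVU h)) Or.inl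
  have hexcS : IsIso (relSingularCohomology.map R R (subsetIncl To)
      (Set.mapsTo_preimage Subtype.val VSᶜ : Set.MapsTo (subsetIncl To) (Subtype.val ⁻¹' VSᶜ) VSᶜ) M) := by
    refine relSingularCohomology.isIso_map_subsetIncl_of_interior R R VSᶜ To ?_ M
    rw [interior_compl, hTo.interior_eq]
    exact eq_univ_of_forall fun s => (em (s ∈ closure VS)).elim (fun h => Or.inr (hVS_closure h))
      Or.inl
  -- (E3) the homeomorphism of pairs `To ≃ₜ U`
  let eZ : (X × (Fin N → Susp.midHeights)) ≃ₜ U := hιemb.isEmbedding.toHomeomorph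
  have heZ : ∀ p, (eZ p : Z) = ι' X N p := fun p => rfl
  let gU : To → U := fun s => ⟨g s.1, (mem_openTube_iff ht hinj τ s.1).2 s.2⟩
  have hgU_cont : Continuous gU := (g.continuous.comp continuous_subtype_val).subtype_mk _
  have hgU_eS : ∀ p, gU (eS t p) = eZ p := fun p => Subtype.ext (by
    rw [heZ]; exact map_tube_coe ht hinj τ p.1 p.2)
  let gUh : To ≃ₜ U :=
    { toFun := gU
      invFun := fun u => eS t (eZ.symm u)
      left_inv := fun s => by
        obtain ⟨p, rfl⟩ := eS_surjective s
        change eS t (eZ.symm (gU (eS t p))) = eS t p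
        rw [hgU_eS, Homeomorph.symm_apply_apply]
      right_inv := fun u => by
        change gU (eS t (eZ.symm u)) = u
        rw [hgU_eS, Homeomorph.apply_symm_apply]
      continuous_toFun := hgU_cont
      continuous_invFun := (continuous_eS ht).comp eZ.symm.continuous }
  have hgUh_maps : Set.MapsTo gUh (Subtype.val ⁻¹' VSᶜ : Set To) (Subtype.val ⁻¹' Vᶜ : Set U) :=
    fun s hs => hs
  have hgUh_symm_maps : Set.MapsTo gUh.symm (Subtype.val ⁻¹' Vᶜ : Set U) (Subtype.val ⁻¹' VSᶜ : Set To) := by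
    intro u hu hmem
    apply hu
    have : (gUh (gUh.symm u) : Z) ∈ V := hmem
    rwa [Homeomorph.apply_symm_apply] at this
  have hisoU : IsIso (relSingularCohomology.map R R (gUh : C(To, U)) hgUh_maps M) :=
    relSingularCohomology.isIso_map_of_homeomorph R R gUh hgUh_maps hgUh_symm_maps M
  -- the square of pairs: `j_Z ∘ gU = g ∘ j_S`
  have hgmaps : Set.MapsTo g VSᶜ Vᶜ := fun s hs => hs
  have hsq : (subsetIncl U).comp (gUh : C(To, U)) = g.comp (subsetIncl To) := by ext s; rfl
  have hsq' : relSingularCohomology.map R R (subsetIncl U) (Set.mapsTo_preimage Subtype.val Vᶜ) M ≫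
      relSingularCohomology.map R R (gUh : C(To, U)) hgUh_maps M =
      relSingularCohomology.map R R g hgmaps M ≫
        relSingularCohomology.map R R (subsetIncl To) (Set.mapsTo_preimage Subtype.val VSᶜ) M := by
    rw [← relSingularCohomology.map_comp, ← relSingularCohomology.map_comp]
    exact relSingularCohomology.map_congr hsq _ _ M
  -- hence `g^*` on relative cohomology is an isomorphism
  have hisoG : IsIso (relSingularCohomology.map R R g hgmaps M) := by
    have e : relSingularCohomology.map R R g hgmaps M =
        (relSingularCohomology.map R R (subsetIncl U) (Set.mapsTo_preimage Subtype.val Vᶜ) M ≫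
          relSingularCohomology.map R R (gUh : C(To, U)) hgUh_maps M) ≫
        inv (relSingularCohomology.map R R (subsetIncl To) (Set.mapsTo_preimage Subtype.val VSᶜ) M) := by
      rw [hsq', Category.assoc, IsIso.hom_inv_id, Category.comp_id]
    rw [e]
    infer_instance
  -- conclude
  obtain ⟨a, ha⟩ : ∃ a : singularCohomology R R S M, a ≠ 0 := by
    by_contra h
    push Not at h
    haveI : Subsingleton (singularCohomology R R S M) := ⟨fun x y => by rw [h x, h y]⟩
    exact hSM (ModuleCat.isZero_of_subsingleton _)
  obtain ⟨b, rfl⟩ := hsurj a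
  let ω := inv (relSingularCohomology.map R R g hgmaps M) b
  refine ⟨relSingularCohomology.toAbsolute R R Z Vᶜ M ω, fun h0 => ha ?_⟩
  have hnat := relSingularCohomology.map_comp_toAbsolute (R := R) (M := R) g hgmaps M
  have h1 : relSingularCohomology.map R R g hgmaps M ω = b := by
    change (inv (relSingularCohomology.map R R g hgmaps M) ≫ relSingularCohomology.map R R g hgmaps M) b = b
    rw [IsIso.inv_hom_id]; rfl
  have h2 := congrArg (fun φ => φ ω) (congrArg (fun f => (ConcreteCategory.hom f)) hnat)
  simp only [ModuleCat.comp_apply] at h2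
  rw [h1] at h2
  rw [h2]
  exact h0

end tubeCollapse

end Literature.AlgebraicTopology.SingularHomology
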